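import Mathlib.RingTheory.ClassGroup.Basic
import Mathlib.NumberTheory.NumberField.Basic
import Literature.NumberTheory.QuadraticFields.FormIdeals
import HarnessLib

/-!
# The ring class group `I_K(f) / P_{K,ℤ}(f)` of a quadratic field (Cox, §7.C–D)

Topic `NumberTheory/QuadraticFields`, namespace `Literature.NumberTheory.QuadraticFields.RingClass`.
Definitions (with bodies; non-Prop plumbing) and theorems; no named facts.

For a number field `K`, an integer `f`, and `𝔣 = f 𝓞 K`, Cox (*Primes of the form x² + ny²*, §7.C,
before Prop. 7.22) defines the subgroup `I_K(f)` of fractional ideals prime to `f` (generated by the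
integral ideals `𝔄` with `𝔄 + 𝔣 = 𝓞 K`) and its subgroup `P_{K,ℤ}(f)` generated by the principal ideals
`α 𝓞 K`, `α ≡ a (mod 𝔣)` for an integer `a` prime to `f`. The quotient `I_K(f)/P_{K,ℤ}(f)` is the
**ring class group** of conductor `f` (it is `≅ C(𝒪)` for the order of conductor `f`, Prop. 7.22, proved
in `RingClassForms.lean`). This file sets up the group theory of §7.D (proof of Thm. 7.24):

* `ringClassNum K f = I_K(f)`, `ringClassDen K f = P_{K,ℤ}(f)` (subgroups of the units of
  `FractionalIdeal (𝓞 K)⁰ K`), `RingClassGroup K f = I_K(f)/P_{K,ℤ}(f)`;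
* `exists_eq_mul_inv_of_mem_ringClassNum` / `…Den` — every element of `I_K(f)` (`P_{K,ℤ}(f)`) is a
  quotient of two generators; `ringClassDen_le_ringClassNum`;
* `toClassGroup` — the natural map `I_K(f)/P_{K,ℤ}(f) → Cl(𝓞 K)`, `[𝔄] ↦ [𝔄]`;
* `prin α` — the unit `α𝓞 K`; `cj`, `nm` — conjugation and norm form on an integral basis `(1, ω)`,
  `ω² = m + tω` of a quadratic `K` (`mul_cj : α ᾱ = N(α)`, `nm_mul`, `isCoprime_nm_of_isUnit`);
* `theta` — **Cox's homomorphism `(𝓞 K/f)ˣ → I_K(f)/P_{K,ℤ}(f)`, `[α] ↦ [α𝓞 K]`** (the proof of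
  (7.27)); well defined since for `α ≡ α' (mod f)`, `(α𝓞)⁻¹(α'𝓞) = (αᾱ𝓞)⁻¹(α'ᾱ𝓞)` with
  `αᾱ = N(α) ∈ ℤ` prime to `f` (`prin_inv_mul_prin_mem_ringClassDen`, `theta_eq`).

The kernel and image of `theta`, the surjectivity of `toClassGroup` and the resulting counting formula
(Cox, Thm. 7.24) are in the sequel files `RingClassNumber.lean`, `RingClassForms.lean`.

## References

* D. A. Cox, *Primes of the form x² + ny²*, 2nd ed., Wiley (2013), §7.C (definitions of `I_K(f)`,
  `P_{K,ℤ}(f)`, Props. 7.20, 7.22) and §7.D (Thm. 7.24, (7.25)–(7.27)). [cite: Cox2013, §7.C–D]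

## Mathlib / tree search

Mathlib: `FractionalIdeal.mk0`, `ClassGroup.mk`, `ClassGroup.mk_mk0`, `ClassGroup.mk0_eq_mk0_iff`,
`ClassGroup.mk_eq_one_iff`, `Subgroup.closure_induction`, `QuotientGroup.lift`, `Subgroup.subgroupOf`,
`Subgroup.index_ker`, `Subgroup.card_mul_index`. Tree: `Quadratic.add_mul_mul_conj`,
`eq_repr_add_repr_mul_of_basis` (`FormIdeals`). No ring class groups in Mathlib or the tree
(`lean search 'ringClass|RingClass'`: only `ringClassField` of `HeegnerPointsOfConductor`).
-/

noncomputable section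

open scoped nonZeroDivisors
open Module NumberField
open Literature.NumberTheory.QuadraticFields.Quadratic

namespace Literature.NumberTheory.QuadraticFields.RingClass

variable (K : Type*) [Field K] [NumberField K] (f : ℕ)

/-! ### `I_K(f)` and `P_{K,ℤ}(f)` -/

/-- The generators of `I_K(f)`: (the invertible fractional ideals of) the integral ideals `𝔄` with
`𝔄 + f𝓞 K = 𝓞 K`. [cite: Cox2013, §7.C (definition of I_K(f))] -/
def numGens : Set (FractionalIdeal (𝓞 K)⁰ K)ˣ :=
  {u | ∃ 𝔄 : Ideal (𝓞 K), 𝔄 ⊔ Ideal.span {(f : 𝓞 K)} = ⊤ ∧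
    (u : FractionalIdeal (𝓞 K)⁰ K) = (𝔄 : FractionalIdeal (𝓞 K)⁰ K)}

/-- The generators of `P_{K,ℤ}(f)`: the principal ideals `α 𝓞 K` with `α ≡ a (mod f𝓞 K)` for an integer
`a` prime to `f`. [cite: Cox2013, §7.C (definition of P_{K,ℤ}(f))] -/
def denGens : Set (FractionalIdeal (𝓞 K)⁰ K)ˣ :=
  {u | ∃ α : 𝓞 K, ∃ a : ℤ, IsCoprime a (f : ℤ) ∧ α - (a : 𝓞 K) ∈ Ideal.span {(f : 𝓞 K)} ∧
    (u : FractionalIdeal (𝓞 K)⁰ K) = FractionalIdeal.spanSingleton (𝓞 K)⁰ (α : K)}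

/-- **`I_K(f)`**: the subgroup of fractional ideals generated by the integral ideals prime to `f`.
[cite: Cox2013, §7.C (definition of I_K(f))] -/
def ringClassNum : Subgroup (FractionalIdeal (𝓞 K)⁰ K)ˣ := Subgroup.closure (numGens K f)

/-- **`P_{K,ℤ}(f)`**: the subgroup generated by the principal ideals `α𝓞 K`, `α ≡ a (mod f)`,
`a ∈ ℤ` prime to `f`. [cite: Cox2013, §7.C (definition of P_{K,ℤ}(f))] -/
def ringClassDen : Subgroup (FractionalIdeal (𝓞 K)⁰ K)ˣ := Subgroup.closure (denGens K f)

/-- **The ring class group `I_K(f) / P_{K,ℤ}(f)`** of conductor `f`. [cite: Cox2013, §7.C Prop. 7.22] -/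
abbrev RingClassGroup : Type _ := (ringClassNum K f) ⧸ (ringClassDen K f).subgroupOf (ringClassNum K f)

variable {K f}

/-! ### Generators -/

/-- The unit of `FractionalIdeal` attached to an ideal prime to `f` (such an ideal is non-zero when
`f` is not a unit… in general we just record non-zeroness as a hypothesis-free consequence of
`𝔄 + 𝔣 = ⊤` with `𝔣 ≠ ⊤`; here we use the `f`-free version: `𝔄 ≠ 0`). [cite: Cox2013, §7.A (fractional ideals of a domain)] -/
theorem mem_nonZeroDivisors_of_ne_bot {R : Type*} [CommRing R] [IsDomain R] {𝔄 : Ideal R} (h : 𝔄 ≠ ⊥) :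
    𝔄 ∈ (Ideal R)⁰ :=
  mem_nonZeroDivisors_of_ne_zero h

/-- An integral ideal prime to `f` gives a generator of `I_K(f)`. [cite: Cox2013, §7.C (definition of I_K(f))] -/
theorem mk0_mem_numGens {𝔄 : Ideal (𝓞 K)} (h𝔄 : 𝔄 ⊔ Ideal.span {(f : 𝓞 K)} = ⊤) (h0 : 𝔄 ≠ ⊥) :
    FractionalIdeal.mk0 K ⟨𝔄, mem_nonZeroDivisors_of_ne_bot h0⟩ ∈ numGens K f :=
  ⟨𝔄, h𝔄, FractionalIdeal.coe_mk0 _ _⟩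

/-- Hence it lies in `I_K(f)`. [cite: Cox2013, §7.C (definition of I_K(f))] -/
theorem mk0_mem_ringClassNum {𝔄 : Ideal (𝓞 K)} (h𝔄 : 𝔄 ⊔ Ideal.span {(f : 𝓞 K)} = ⊤) (h0 : 𝔄 ≠ ⊥) :
    FractionalIdeal.mk0 K ⟨𝔄, mem_nonZeroDivisors_of_ne_bot h0⟩ ∈ ringClassNum K f :=
  Subgroup.subset_closure (mk0_mem_numGens h𝔄 h0)

/-- `1 ∈ numGens`. [cite: Cox2013, §7.C (definition of I_K(f))] -/
theorem one_mem_numGens : (1 : (FractionalIdeal (𝓞 K)⁰ K)ˣ) ∈ numGens K f :=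
  ⟨⊤, by simp, by simp⟩

/-- `numGens` is closed under multiplication (a product of ideals prime to `f` is prime to `f`).
[cite: Cox2013, §7.C (definition of I_K(f))] -/
theorem mul_mem_numGens {u v : (FractionalIdeal (𝓞 K)⁰ K)ˣ} (hu : u ∈ numGens K f)
    (hv : v ∈ numGens K f) : u * v ∈ numGens K f := by
  obtain ⟨𝔄, h𝔄, hu⟩ := hu
  obtain ⟨𝔅, h𝔅, hv⟩ := hv
  refine ⟨𝔄 * 𝔅, ?_, by rw [Units.val_mul, hu, hv, FractionalIdeal.coeIdeal_mul]⟩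
  rw [sup_comm] at h𝔄 h𝔅 ⊢
  rw [Ideal.sup_mul_eq_of_coprime_left h𝔄, h𝔅]

/-- In a commutative group, the closure of a multiplicatively closed set containing `1` consists of
the quotients `s t⁻¹`, `s, t` in the set. [folklore] -/
private theorem exists_eq_mul_inv_of_mem_closure {G : Type*} [CommGroup G] {S : Set G} (h1 : (1 : G) ∈ S)
    (hmul : ∀ {x y}, x ∈ S → y ∈ S → x * y ∈ S) {g : G} (hg : g ∈ Subgroup.closure S) :
    ∃ s ∈ S, ∃ t ∈ S, g = s * t⁻¹ := by
  induction hg using Subgroup.closure_induction with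
  | mem x hx => exact ⟨x, hx, 1, h1, by simp⟩
  | one => exact ⟨1, h1, 1, h1, by simp⟩
  | mul x y _ _ ihx ihy =>
    obtain ⟨s, hs, t, ht, rfl⟩ := ihx
    obtain ⟨s', hs', t', ht', rfl⟩ := ihy
    exact ⟨s * s', hmul hs hs', t * t', hmul ht ht', by rw [mul_inv]; simp only [mul_assoc, mul_left_comm]⟩
  | inv x _ ihx =>
    obtain ⟨s, hs, t, ht, rfl⟩ := ihx
    exact ⟨t, ht, s, hs, by rw [mul_inv, inv_inv, mul_comm]⟩

/-- **Elements of `I_K(f)`**: every element is `𝔄 · 𝔅⁻¹` with `𝔄, 𝔅` integral ideals prime to `f`.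
[cite: Cox2013, §7.C (definition of I_K(f))] -/
theorem exists_eq_mul_inv_of_mem_ringClassNum {u : (FractionalIdeal (𝓞 K)⁰ K)ˣ}
    (hu : u ∈ ringClassNum K f) :
    ∃ s ∈ numGens K f, ∃ t ∈ numGens K f, u = s * t⁻¹ :=
  exists_eq_mul_inv_of_mem_closure one_mem_numGens mul_mem_numGens hu

omit [NumberField K] in
/-- A generator of `P_{K,ℤ}(f)` is the (invertible) principal ideal of its element `α`, and `α𝓞 K`
is prime to `f`. [cite: Cox2013, §7.C (definition of P_{K,ℤ}(f))] -/
theorem span_sup_eq_top_of_sub_mem {α : 𝓞 K} {a : ℤ} (ha : IsCoprime a (f : ℤ))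
    (hα : α - (a : 𝓞 K) ∈ Ideal.span {(f : 𝓞 K)}) : Ideal.span {α} ⊔ Ideal.span {(f : 𝓞 K)} = ⊤ := by
  rw [Ideal.eq_top_iff_one]
  obtain ⟨u, v, huv⟩ := ha
  have h1 : (1 : 𝓞 K) = (u : 𝓞 K) * α - (u : 𝓞 K) * (α - a) + (v : 𝓞 K) * (f : 𝓞 K) := by
    have := congrArg (Int.cast : ℤ → 𝓞 K) huv
    push_cast at this
    linear_combination -this
  rw [h1]
  refine Submodule.add_mem _ (Submodule.sub_mem _ ?_ ?_) ?_
  · exact Ideal.mem_sup_left (Ideal.mul_mem_left _ _ (Ideal.mem_span_singleton_self α))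
  · exact Ideal.mem_sup_right (Ideal.mul_mem_left _ _ hα)
  · exact Ideal.mem_sup_right (Ideal.mul_mem_left _ _ (Ideal.mem_span_singleton_self _))

/-- `1 ∈ denGens` (`α = a = 1`). [cite: Cox2013, §7.C (definition of P_{K,ℤ}(f))] -/
theorem one_mem_denGens : (1 : (FractionalIdeal (𝓞 K)⁰ K)ˣ) ∈ denGens K f :=
  ⟨1, 1, isCoprime_one_left, by simp, by simp⟩

/-- `denGens` is closed under multiplication (`αβ ≡ ab (mod f)`). [cite: Cox2013, §7.C (definition of P_{K,ℤ}(f))] -/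
theorem mul_mem_denGens {u v : (FractionalIdeal (𝓞 K)⁰ K)ˣ} (hu : u ∈ denGens K f)
    (hv : v ∈ denGens K f) : u * v ∈ denGens K f := by
  obtain ⟨α, a, ha, hα, hu⟩ := hu
  obtain ⟨β, b', hb, hβ, hv⟩ := hv
  refine ⟨α * β, a * b', ha.mul_left hb, ?_, ?_⟩
  · have : α * β - ((a * b' : ℤ) : 𝓞 K) = α * (β - (b' : 𝓞 K)) + (b' : 𝓞 K) * (α - (a : 𝓞 K)) := by
      push_cast; ring
    rw [this]
    exact Ideal.add_mem _ (Ideal.mul_mem_left _ _ hβ) (Ideal.mul_mem_left _ _ hα)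
  · rw [Units.val_mul, hu, hv, FractionalIdeal.spanSingleton_mul_spanSingleton]
    push_cast
    rfl

/-- **Elements of `P_{K,ℤ}(f)`** are quotients of two generators. [cite: Cox2013, §7.C (definition of P_{K,ℤ}(f))] -/
theorem exists_eq_mul_inv_of_mem_ringClassDen {u : (FractionalIdeal (𝓞 K)⁰ K)ˣ}
    (hu : u ∈ ringClassDen K f) :
    ∃ s ∈ denGens K f, ∃ t ∈ denGens K f, u = s * t⁻¹ :=
  exists_eq_mul_inv_of_mem_closure one_mem_denGens mul_mem_denGens hu

/-- `denGens ⊆ numGens` (the principal ideal `α𝓞 K`, `α ≡ a`, `gcd(a,f) = 1`, is prime to `f`).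
[cite: Cox2013, §7.C (P_{K,ℤ}(f) ⊆ I_K(f))] -/
theorem denGens_subset_numGens : denGens K f ⊆ numGens K f := by
  rintro u ⟨α, a, ha, hα, hu⟩
  exact ⟨Ideal.span {α}, span_sup_eq_top_of_sub_mem ha hα,
    by rw [hu, FractionalIdeal.coeIdeal_span_singleton]⟩

/-- **`P_{K,ℤ}(f) ≤ I_K(f)`**. [cite: Cox2013, §7.C (P_{K,ℤ}(f) ⊆ I_K(f))] -/
theorem ringClassDen_le_ringClassNum : ringClassDen K f ≤ ringClassNum K f :=
  Subgroup.closure_mono denGens_subset_numGens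

/-! ### The map to the class group -/

/-- Generators of `P_{K,ℤ}(f)` are principal, so they die in `Cl(𝓞 K)`. [cite: Cox2013, §7.D (7.25)] -/
theorem classGroupMk_eq_one_of_mem_denGens {u : (FractionalIdeal (𝓞 K)⁰ K)ˣ} (hu : u ∈ denGens K f) :
    ClassGroup.mk K u = 1 := by
  obtain ⟨α, a, -, -, hu⟩ := hu
  rw [ClassGroup.mk_eq_one_iff, FractionalIdeal.isPrincipal_iff]
  exact ⟨α, hu⟩

/-- `P_{K,ℤ}(f)` dies in `Cl(𝓞 K)`. [cite: Cox2013, §7.D (7.25)] -/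
theorem classGroupMk_eq_one_of_mem_ringClassDen {u : (FractionalIdeal (𝓞 K)⁰ K)ˣ}
    (hu : u ∈ ringClassDen K f) : ClassGroup.mk K u = 1 := by
  obtain ⟨s, hs, t, ht, rfl⟩ := exists_eq_mul_inv_of_mem_ringClassDen hu
  rw [map_mul, map_inv, classGroupMk_eq_one_of_mem_denGens hs, classGroupMk_eq_one_of_mem_denGens ht]
  simp

variable (K f) in
/-- **The natural map `I_K(f)/P_{K,ℤ}(f) → Cl(𝓞 K)`**, `[𝔄] ↦ [𝔄]`. [cite: Cox2013, §7.D (7.25)] -/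
def toClassGroup : RingClassGroup K f →* ClassGroup (𝓞 K) :=
  QuotientGroup.lift _ ((ClassGroup.mk K).comp (ringClassNum K f).subtype) (by
    intro u hu
    rw [Subgroup.mem_subgroupOf] at hu
    exact classGroupMk_eq_one_of_mem_ringClassDen hu)

/-- `toClassGroup [u] = ClassGroup.mk u`. [cite: Cox2013, §7.D (7.25)] -/
theorem toClassGroup_mk (u : ringClassNum K f) :
    toClassGroup K f (QuotientGroup.mk u) = ClassGroup.mk K (u : (FractionalIdeal (𝓞 K)⁰ K)ˣ) :=
  QuotientGroup.lift_mk _ _ _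

/-! ### Principal units of `FractionalIdeal` -/

variable (K) in
/-- The invertible fractional ideal `α 𝓞 K` of a non-zero `α ∈ 𝓞 K`. [folklore] -/
def prin (α : 𝓞 K) (hα : α ≠ 0) : (FractionalIdeal (𝓞 K)⁰ K)ˣ :=
  toPrincipalIdeal (𝓞 K) K (Units.mk0 (α : K) (RingOfIntegers.coe_ne_zero_iff.2 hα))

/-- `↑(prin α) = spanSingleton α`. [cite: Cox2013, §7.A (principal fractional ideals P(𝒪))] -/
theorem coe_prin (α : 𝓞 K) (hα : α ≠ 0) :
    (prin K α hα : FractionalIdeal (𝓞 K)⁰ K) = FractionalIdeal.spanSingleton (𝓞 K)⁰ (α : K) := by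
  rw [prin, coe_toPrincipalIdeal, Units.val_mk0]

/-- `↑(prin α) = ↑(span {α})`. [cite: Cox2013, §7.A (principal fractional ideals P(𝒪))] -/
theorem coe_prin' (α : 𝓞 K) (hα : α ≠ 0) :
    (prin K α hα : FractionalIdeal (𝓞 K)⁰ K) = ((Ideal.span {α} : Ideal (𝓞 K)) : FractionalIdeal (𝓞 K)⁰ K) := by
  rw [coe_prin, FractionalIdeal.coeIdeal_span_singleton]

/-- `prin (αβ) = prin α · prin β`. [cite: Cox2013, §7.A (principal fractional ideals P(𝒪))] -/
theorem prin_mul (α β : 𝓞 K) (hα : α ≠ 0) (hβ : β ≠ 0) :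
    prin K (α * β) (mul_ne_zero hα hβ) = prin K α hα * prin K β hβ := by
  rw [prin, prin, prin, ← map_mul]
  congr 1
  ext
  simp

/-- `prin 1 = 1`. [cite: Cox2013, §7.A (principal fractional ideals P(𝒪))] -/
theorem prin_one : prin K (1 : 𝓞 K) one_ne_zero = 1 := by
  ext
  rw [coe_prin]
  simp

/-- `prin ε = 1` for a unit `ε`. [cite: Cox2013, §7.A (principal fractional ideals P(𝒪))] -/
theorem prin_unit (ε : (𝓞 K)ˣ) : prin K (ε : 𝓞 K) ε.ne_zero = 1 := by
  ext
  rw [coe_prin', Ideal.span_singleton_eq_top.2 ε.isUnit]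
  simp

/-- `prin α = mk0 (span {α})`. [cite: Cox2013, §7.A (principal fractional ideals P(𝒪))] -/
theorem prin_eq_mk0 (α : 𝓞 K) (hα : α ≠ 0) :
    prin K α hα = FractionalIdeal.mk0 K ⟨Ideal.span {α},
      mem_nonZeroDivisors_of_ne_bot (by rwa [ne_eq, Ideal.span_singleton_eq_bot])⟩ := by
  ext
  rw [coe_prin', FractionalIdeal.coe_mk0]

/-- `prin α ∈ I_K(f)` when `α𝓞 K` is prime to `f`. [cite: Cox2013, §7.C (definition of I_K(f))] -/
theorem prin_mem_ringClassNum {α : 𝓞 K} (hα : α ≠ 0)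
    (h : Ideal.span {α} ⊔ Ideal.span {(f : 𝓞 K)} = ⊤) : prin K α hα ∈ ringClassNum K f :=
  Subgroup.subset_closure ⟨Ideal.span {α}, h, coe_prin' α hα⟩

/-- `prin α ∈ denGens` when `α ≡ a (mod f)`, `gcd(a, f) = 1`. [cite: Cox2013, §7.C (definition of P_{K,ℤ}(f))] -/
theorem prin_mem_denGens {α : 𝓞 K} (hα : α ≠ 0) {a : ℤ} (ha : IsCoprime a (f : ℤ))
    (h : α - (a : 𝓞 K) ∈ Ideal.span {(f : 𝓞 K)}) : prin K α hα ∈ denGens K f :=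
  ⟨α, a, ha, h, coe_prin α hα⟩

/-- `prin α ∈ P_{K,ℤ}(f)` when `α ≡ a (mod f)`, `gcd(a, f) = 1`. [cite: Cox2013, §7.C (definition of P_{K,ℤ}(f))] -/
theorem prin_mem_ringClassDen {α : 𝓞 K} (hα : α ≠ 0) {a : ℤ} (ha : IsCoprime a (f : ℤ))
    (h : α - (a : 𝓞 K) ∈ Ideal.span {(f : 𝓞 K)}) : prin K α hα ∈ ringClassDen K f :=
  Subgroup.subset_closure (prin_mem_denGens hα ha h)

/-! ### The conjugation and the norm form on an integral basis `(1, ω)`, `ω² = m + tω` -/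

section Conj

variable (b : Basis (Fin 2) ℤ (𝓞 K)) (hb : b 0 = 1) {t m : ℤ}
  (hω : b 1 * b 1 = (m : 𝓞 K) + (t : 𝓞 K) * b 1)

/-- The conjugate `x̄ = (x₀ + t x₁) − x₁ ω` of `x = x₀ + x₁ ω`. [folklore] -/
def cj (x : 𝓞 K) : 𝓞 K := ((b.repr x 0 + t * b.repr x 1 : ℤ) : 𝓞 K) - (b.repr x 1 : 𝓞 K) * b 1

/-- The norm form `N(x) = x₀² + t x₀ x₁ − m x₁²` of `x = x₀ + x₁ ω`. [folklore] -/
def nm (x : 𝓞 K) : ℤ := b.repr x 0 ^ 2 + t * b.repr x 0 * b.repr x 1 - m * b.repr x 1 ^ 2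

omit [NumberField K] in
include hb hω in
/-- `x · x̄ = N(x)`. [cite: Cox2013, §7.A (7.1) (the norm form of a quadratic order)] -/
theorem mul_cj (x : 𝓞 K) : x * cj b (t := t) x = (nm b (t := t) (m := m) x : 𝓞 K) := by
  rw [cj, nm]
  have h := add_mul_mul_conj b hω (b.repr x 0) (b.repr x 1)
  rw [← eq_repr_add_repr_mul_of_basis b hb x] at h
  exact h

omit [NumberField K] in
include hb hω in
/-- Coordinates of a product: `(u + vω)(u' + v'ω) = (uu' + m vv') + (uv' + u'v + t vv') ω`. [cite: Cox2013, §7.A (7.1)–(7.2) (arithmetic on the basis 1, ω)] -/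
theorem repr_mul (x y : 𝓞 K) :
    b.repr (x * y) 0 = b.repr x 0 * b.repr y 0 + m * (b.repr x 1 * b.repr y 1) ∧
    b.repr (x * y) 1 = b.repr x 0 * b.repr y 1 + b.repr y 0 * b.repr x 1 + t * (b.repr x 1 * b.repr y 1) := by
  have hxy : x * y = ((b.repr x 0 * b.repr y 0 + m * (b.repr x 1 * b.repr y 1) : ℤ) : 𝓞 K) +
      ((b.repr x 0 * b.repr y 1 + b.repr y 0 * b.repr x 1 + t * (b.repr x 1 * b.repr y 1) : ℤ) : 𝓞 K) * b 1 := by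
    conv_lhs => rw [eq_repr_add_repr_mul_of_basis b hb x, eq_repr_add_repr_mul_of_basis b hb y]
    push_cast
    linear_combination ((b.repr x 1 : 𝓞 K) * (b.repr y 1 : 𝓞 K)) * hω
  constructor
  · conv_lhs => rw [hxy]
    rw [repr_intCast_add_intCast_mul_zero b hb]
  · conv_lhs => rw [hxy]
    rw [repr_intCast_add_intCast_mul_one b hb]

omit [NumberField K] in
include hb hω in
/-- The conjugation is multiplicative. [cite: Cox2013, §7.A (7.1) (the conjugation of a quadratic field)] -/
theorem cj_mul (x y : 𝓞 K) : cj b (t := t) (x * y) = cj b (t := t) x * cj b (t := t) y := by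
  obtain ⟨h0, h1⟩ := repr_mul b hb hω x y
  rw [cj, cj, cj, h0, h1]
  push_cast
  linear_combination (-((b.repr x 1 : 𝓞 K) * (b.repr y 1 : 𝓞 K))) * hω

include hb hω in
/-- The norm form is multiplicative. [cite: Cox2013, §7.A (7.1)] -/
theorem nm_mul (x y : 𝓞 K) : nm b (t := t) (m := m) (x * y) = nm b (t := t) (m := m) x * nm b (t := t) (m := m) y := by
  have h : ((nm b (t := t) (m := m) (x * y) : ℤ) : 𝓞 K) = ((nm b (t := t) (m := m) x * nm b (t := t) (m := m) y : ℤ) : 𝓞 K) := by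
    rw [← mul_cj b hb hω, cj_mul b hb hω, Int.cast_mul, ← mul_cj b hb hω, ← mul_cj b hb hω]
    ring
  exact_mod_cast h

omit [NumberField K] in
/-- An element of `f 𝓞 K` has both coordinates divisible by `f`. [cite: Cox2013, §7.A Lemma 7.2 (f𝒪_K on the basis 1, ω)] -/
theorem dvd_repr_of_mem_span {x : 𝓞 K} (hx : x ∈ Ideal.span {(f : 𝓞 K)}) (i : Fin 2) :
    (f : ℤ) ∣ b.repr x i := by
  obtain ⟨y, rfl⟩ := Ideal.mem_span_singleton'.1 hx
  refine ⟨b.repr y i, ?_⟩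
  have : y * (f : 𝓞 K) = (f : ℤ) • y := by rw [zsmul_eq_mul]; push_cast; ring
  rw [this, map_zsmul, Finsupp.smul_apply, smul_eq_mul]

omit [NumberField K] in
include hb in
/-- `N(x) ≡ 1 (mod f)` for `x ≡ 1 (mod f 𝓞 K)`. [cite: Cox2013, §7.C Lemma 7.18] -/
theorem nm_sub_one_dvd {x : 𝓞 K} (hx : x - 1 ∈ Ideal.span {(f : 𝓞 K)}) :
    (f : ℤ) ∣ nm b (t := t) (m := m) x - 1 := by
  obtain ⟨c0, h0⟩ := dvd_repr_of_mem_span b hx 0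
  obtain ⟨c1, h1⟩ := dvd_repr_of_mem_span b hx 1
  rw [map_sub, Finsupp.sub_apply, ← hb, b.repr_self] at h0 h1
  have e0 : (Finsupp.single (0 : Fin 2) (1 : ℤ)) 0 = 1 := Finsupp.single_eq_same
  have e1 : (Finsupp.single (0 : Fin 2) (1 : ℤ)) 1 = 0 := by rw [Finsupp.single_apply]; decide
  rw [e0] at h0
  rw [e1, sub_zero] at h1
  have hx0 : b.repr x 0 = 1 + f * c0 := by linarith
  rw [nm, hx0, h1]
  exact ⟨2 * c0 + f * c0 ^ 2 + t * c1 + t * f * c0 * c1 - m * f * c1 ^ 2, by ring⟩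

include hb hω in
/-- **The norm of an element invertible modulo `f` is prime to `f`.** [cite: Cox2013, §7.C Lemma 7.18] -/
theorem isCoprime_nm_of_isUnit {x : 𝓞 K}
    (hx : IsUnit (Ideal.Quotient.mk (Ideal.span {(f : 𝓞 K)}) x)) :
    IsCoprime (nm b (t := t) (m := m) x) (f : ℤ) := by
  obtain ⟨u, hu⟩ := hx
  obtain ⟨y, hy⟩ := Ideal.Quotient.mk_surjective ((u⁻¹ : (𝓞 K ⧸ Ideal.span {(f : 𝓞 K)})ˣ) : 𝓞 K ⧸ Ideal.span {(f : 𝓞 K)})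
  have hxy : x * y - 1 ∈ Ideal.span {(f : 𝓞 K)} := by
    rw [← Ideal.Quotient.eq, map_mul, map_one, ← hu, hy, Units.mul_inv]
  obtain ⟨c, hc⟩ := nm_sub_one_dvd b hb (t := t) (m := m) hxy
  rw [nm_mul b hb hω] at hc
  exact ⟨nm b (t := t) (m := m) y, -c, by linarith⟩

end Conj

/-! ### Cox's map `(𝓞 K / f)ˣ → I_K(f)/P_{K,ℤ}(f)`, `[α] ↦ [α 𝓞 K]` -/

section Theta

variable (b : Basis (Fin 2) ℤ (𝓞 K)) (hb : b 0 = 1) {t m : ℤ}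
  (hω : b 1 * b 1 = (m : 𝓞 K) + (t : 𝓞 K) * b 1)
variable (hf : Ideal.span {(f : 𝓞 K)} ≠ ⊤)

omit [NumberField K] in
include hf in
/-- A lift of a unit of `𝓞 K / f` is non-zero and generates an ideal prime to `f`. [cite: Cox2013, §7.D (7.27) (units of 𝒪_K/f𝒪_K)] -/
theorem ne_zero_and_sup_eq_top_of_isUnit {α : 𝓞 K}
    (hα : IsUnit (Ideal.Quotient.mk (Ideal.span {(f : 𝓞 K)}) α)) :
    α ≠ 0 ∧ Ideal.span {α} ⊔ Ideal.span {(f : 𝓞 K)} = ⊤ := by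
  obtain ⟨u, hu⟩ := hα
  obtain ⟨y, hy⟩ := Ideal.Quotient.mk_surjective ((u⁻¹ : (𝓞 K ⧸ Ideal.span {(f : 𝓞 K)})ˣ) : 𝓞 K ⧸ Ideal.span {(f : 𝓞 K)})
  have hxy : α * y - 1 ∈ Ideal.span {(f : 𝓞 K)} := by
    rw [← Ideal.Quotient.eq, map_mul, map_one, ← hu, hy, Units.mul_inv]
  have htop : Ideal.span {α} ⊔ Ideal.span {(f : 𝓞 K)} = ⊤ := by
    rw [Ideal.eq_top_iff_one]
    have : (1 : 𝓞 K) = y * α - (α * y - 1) := by ring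
    rw [this]
    exact Submodule.sub_mem _ (Ideal.mem_sup_left (Ideal.mul_mem_left _ _ (Ideal.mem_span_singleton_self α)))
      (Ideal.mem_sup_right hxy)
  refine ⟨?_, htop⟩
  rintro rfl
  apply hf
  rwa [Ideal.span_singleton_zero, bot_sup_eq] at htop

include hf in
/-- `𝔣 ≠ ⊤` means `f ≠ 1`… precisely: an integer `n` with `IsCoprime n f`-partner… (helper) if `n = 0` is
coprime to `f` then `f` is a unit, contradicting `𝔣 ≠ ⊤`. [cite: Cox2013, §7.D (7.27)] -/
theorem ne_zero_of_isCoprime {n : ℤ} (hn : IsCoprime n (f : ℤ)) : n ≠ 0 := by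
  rintro rfl
  rw [isCoprime_zero_left, Int.isUnit_iff] at hn
  apply hf
  rw [Ideal.eq_top_iff_one]
  rcases hn with h | h
  · have h1 : (f : 𝓞 K) = 1 := by exact_mod_cast (show (f : ℤ) = 1 from h) ▸ (by norm_cast : ((f : ℤ) : 𝓞 K) = (f : 𝓞 K)).symm
    rw [← h1]; exact Ideal.mem_span_singleton_self _
  · exact absurd h (by omega)

include hb hω hf in
/-- **Well-definedness of `[α] ↦ [α𝓞 K]`** (Cox, proof of (7.27)): if `α ≡ α' (mod f)` are invertible
modulo `f`, then `(α𝓞 K)⁻¹ (α'𝓞 K) = (αᾱ 𝓞 K)⁻¹ (α'ᾱ 𝓞 K) ∈ P_{K,ℤ}(f)`, as `αᾱ = N(α) ∈ ℤ` is prime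
to `f` and `α'ᾱ ≡ N(α) (mod f)`. [cite: Cox2013, §7.D (7.27)] -/
theorem prin_inv_mul_prin_mem_ringClassDen {α α' : 𝓞 K}
    (hα : IsUnit (Ideal.Quotient.mk (Ideal.span {(f : 𝓞 K)}) α)) (hα0 : α ≠ 0) (hα'0 : α' ≠ 0)
    (h : α - α' ∈ Ideal.span {(f : 𝓞 K)}) :
    (prin K α hα0)⁻¹ * prin K α' hα'0 ∈ ringClassDen K f := by
  have hn : IsCoprime (nm b (t := t) (m := m) α) (f : ℤ) := isCoprime_nm_of_isUnit b hb hω hα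
  have hn0 : nm b (t := t) (m := m) α ≠ 0 := ne_zero_of_isCoprime hf hn
  have hcj0 : cj b (t := t) α ≠ 0 := by
    intro h0
    have := mul_cj b hb hω (m := m) α
    rw [h0, mul_zero] at this
    exact hn0 (by exact_mod_cast this.symm)
  have key : (prin K α hα0)⁻¹ * prin K α' hα'0 =
      (prin K (α * cj b (t := t) α) (mul_ne_zero hα0 hcj0))⁻¹ *
        prin K (α' * cj b (t := t) α) (mul_ne_zero hα'0 hcj0) := by
    rw [prin_mul α (cj b (t := t) α) hα0 hcj0, prin_mul α' (cj b (t := t) α) hα'0 hcj0, mul_inv, mul_assoc,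
      mul_comm (prin K (cj b α) hcj0)⁻¹, mul_assoc, mul_inv_cancel, mul_one]
  rw [key]
  refine Subgroup.mul_mem _ (Subgroup.inv_mem _ (prin_mem_ringClassDen _ hn ?_)) (prin_mem_ringClassDen _ hn ?_)
  · rw [mul_cj b hb hω (m := m), sub_self]; exact Submodule.zero_mem _
  · have : α' * cj b (t := t) α - (nm b (t := t) (m := m) α : 𝓞 K) = -((α - α') * cj b (t := t) α) := by
      rw [← mul_cj b hb hω (m := m)]; ring
    rw [this]
    exact Submodule.neg_mem _ (Ideal.mul_mem_right _ _ h)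

/-- A chosen lift of a unit of `𝓞 K / f`. [folklore] -/
def liftU (x : (𝓞 K ⧸ Ideal.span {(f : 𝓞 K)})ˣ) : 𝓞 K :=
  (Ideal.Quotient.mk_surjective (x : 𝓞 K ⧸ Ideal.span {(f : 𝓞 K)})).choose

omit [NumberField K] in
/-- The chosen lift maps to `x`. [cite: Cox2013, §7.D (7.27) (units of 𝒪_K/f𝒪_K)] -/
theorem mk_liftU (x : (𝓞 K ⧸ Ideal.span {(f : 𝓞 K)})ˣ) :
    Ideal.Quotient.mk (Ideal.span {(f : 𝓞 K)}) (liftU x) = x :=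
  (Ideal.Quotient.mk_surjective (x : 𝓞 K ⧸ Ideal.span {(f : 𝓞 K)})).choose_spec

omit [NumberField K] in
/-- The chosen lift is invertible modulo `f`. [cite: Cox2013, §7.D (7.27) (units of 𝒪_K/f𝒪_K)] -/
theorem isUnit_mk_liftU (x : (𝓞 K ⧸ Ideal.span {(f : 𝓞 K)})ˣ) :
    IsUnit (Ideal.Quotient.mk (Ideal.span {(f : 𝓞 K)}) (liftU x)) := by
  rw [mk_liftU]; exact Units.isUnit x

variable (K f) in
include hf in
/-- The raw map `x ↦ [liftU x · 𝓞 K]`. [cite: Cox2013, §7.D (7.27)] -/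
def thetaFun (x : (𝓞 K ⧸ Ideal.span {(f : 𝓞 K)})ˣ) : RingClassGroup K f :=
  QuotientGroup.mk ⟨prin K (liftU x) (ne_zero_and_sup_eq_top_of_isUnit hf (isUnit_mk_liftU x)).1,
    prin_mem_ringClassNum _ (ne_zero_and_sup_eq_top_of_isUnit hf (isUnit_mk_liftU x)).2⟩

include hb hω in
/-- `thetaFun x = [α 𝓞 K]` for ANY lift `α` of `x`. [cite: Cox2013, §7.D (7.27)] -/
theorem thetaFun_eq {x : (𝓞 K ⧸ Ideal.span {(f : 𝓞 K)})ˣ} {α : 𝓞 K}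
    (hα : Ideal.Quotient.mk (Ideal.span {(f : 𝓞 K)}) α = x) :
    thetaFun K f hf x = QuotientGroup.mk ⟨prin K α
        (ne_zero_and_sup_eq_top_of_isUnit hf (hα ▸ Units.isUnit x)).1,
      prin_mem_ringClassNum _ (ne_zero_and_sup_eq_top_of_isUnit hf (hα ▸ Units.isUnit x)).2⟩ := by
  rw [thetaFun, QuotientGroup.eq, Subgroup.mem_subgroupOf]
  have h : liftU x - α ∈ Ideal.span {(f : 𝓞 K)} := by rw [← Ideal.Quotient.eq, mk_liftU, hα]
  exact prin_inv_mul_prin_mem_ringClassDen b hb hω hf (isUnit_mk_liftU x)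
    (ne_zero_and_sup_eq_top_of_isUnit hf (isUnit_mk_liftU x)).1
    (ne_zero_and_sup_eq_top_of_isUnit hf (hα ▸ Units.isUnit x)).1 h

variable (K f) in
include hb hω in
/-- **Cox's homomorphism `(𝓞 K / f)ˣ → I_K(f)/P_{K,ℤ}(f)`, `[α] ↦ [α 𝓞 K]`.** [cite: Cox2013, §7.D (7.27)] -/
def theta : (𝓞 K ⧸ Ideal.span {(f : 𝓞 K)})ˣ →* RingClassGroup K f where
  toFun := thetaFun K f hf
  map_one' := by
    rw [thetaFun_eq b hb hω hf (α := 1) (by simp)]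
    have : prin K (1 : 𝓞 K) one_ne_zero = 1 := prin_one
    rw [QuotientGroup.eq_one_iff]
    simp only [this]
    exact Subgroup.one_mem _
  map_mul' x y := by
    rw [thetaFun_eq b hb hω hf (α := liftU x * liftU y) (by rw [map_mul, mk_liftU, mk_liftU]; rfl),
      thetaFun, thetaFun, ← QuotientGroup.mk_mul]
    congr 1
    ext1
    simp only [Subgroup.coe_mul]
    exact prin_mul _ _ _ _

include hb hω in
/-- `theta x = [α 𝓞 K]` for any lift `α` of `x`. [cite: Cox2013, §7.D (7.27)] -/
theorem theta_eq {x : (𝓞 K ⧸ Ideal.span {(f : 𝓞 K)})ˣ} {α : 𝓞 K}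
    (hα : Ideal.Quotient.mk (Ideal.span {(f : 𝓞 K)}) α = x) :
    theta K f b hb hω hf x = QuotientGroup.mk ⟨prin K α
        (ne_zero_and_sup_eq_top_of_isUnit hf (hα ▸ Units.isUnit x)).1,
      prin_mem_ringClassNum _ (ne_zero_and_sup_eq_top_of_isUnit hf (hα ▸ Units.isUnit x)).2⟩ :=
  thetaFun_eq b hb hω hf hα

end Theta

end Literature.NumberTheory.QuadraticFields.RingClass
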